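import Summits.BirchSwinnertonDyer.BirchSwinnertonDyer.Theorems.PrintCf2RubinValueTwoColemanCoinvariantCharTrace
import Literature.NumberTheory.EllipticCurves.IwasawaAlgebraCharIdealTwoSidedSandwichProofs
import Literature.NumberTheory.GaloisRepresentations.LocalFieldDyadicPrincipalUnits
import HarnessLib

/-!
# Brick (c) at `p = 2`, local `χ`-part: TWO closed `Γ_F`-stable subgroups `C₁, C₂ ⊆ 𝒰¹_∞` whose Coleman ideals `φ_ε(Col_Σ C_j)` contain each
# other up to a height-two pair and a power of `2` have `char_Λ((N_Σ/Col_Σ C₂)_ε)·(2)^i = char_Λ((N_Σ/Col_Σ C₁)_ε)·(2)^{i′}` — the algebraic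
# skeleton of de Shalit III §1.4 / Lemma 1.10's comparison of two elliptic-unit closures (item D4χ)

Cell `bsd-print-cf2`, width seat `bsd-line-cf2c-w7` g26, route C `PrintCf2RubinValueTwo`, crux of record stmt-BirchSwinnertonDyer-24033
`TwoVariableMainConjAtSplitTwoQuad` (23720 nominal), BRICK §4(c), item D4χ (`BrickCD4Chi.BrickCD4ChiClosureComparison`, memo
`Cruxes/TwoVariableMainConjAtSplitTwoQuad/BRICK-C-D4-g25.md`); `--supports` the crux as a helper.  THEOREMS ONLY (0 sorry, no named fact, no
definition); Theses-free.  BSD is not proved by any of this.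

WHY.  Item D4χ concludes `∃ i i′, char_Λ((N_Σ/Col_Σ B_χ)_ε)·(2)^i = char_Λ((N_Σ/Col_Σ A_χ)_ε)·(2)^{i′}` for the Shapiro image `B_χ` of Rubin's closure and
the closure `A_χ` of the averaged theta units.  By `ColemanCoinvariantTrace.charIdeal_coinvariants_colemanImageTrace_eq` BOTH sides are
`char_Λ(Λ ⧸ I_j)` with `I_j := φ_ε(Col_Σ C_j) ≤ Λ = 𝒪_F⟦X⟧⟦T⟧`, so the item is a statement about two IDEALS, and the tree's generic two-sided sandwich
(`Module.exists_charIdeal_quotient_mul_span_pow_eq_of_two_sided_sandwich`: `(f₁, g₁)·I_A ⊆ I_B`, `2^k·(f₂, g₂)·I_B ⊆ I_A` for prime `f_j ∤ g_j`) is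
exactly the shape the arithmetic supplies — D4a/D4b (`(σ̃_𝔞 − N𝔞)·A_χ ⊆ B_χ`: the augmentation pair, de Shalit II §4.12) and D4c/(γ)/(2)-slack
(`B_χ ⊆ A_χ` up to a liftable pair and `(2)^k`).  THIS file is that reduction, for the generic lane data (any local field `F` with `#𝓀 = 2` and a
uniformiser `π` with `2 = π·t`, so that `2` is a PRIME of `Λ`):

* §1 `prime_two_integer` (`2 = π·t`, `t` a unit ⟹ `2` prime in `𝒪_F`), ★ `prime_two_powerSeries_powerSeries` (`2 = C (C 2)` prime in `𝒪_F⟦X⟧⟦T⟧`,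
  twice the tree's `prime_C_of_prime`);
* §2 ★★★ **`exists_charIdeal_coinvariants_colemanImageTrace_mul_span_two_pow_eq_of_sandwich`** — for closed `Γ_F`-stable subgroups `C₁, C₂ ⊆ 𝒰¹_∞`
  (any `d`, `ℕ` dense in `𝒪_F`), `ε² = 1`, prime elements `f₁ ∤ g₁`, `f₂ ∤ g₂` of `Λ` and `k` with `f₁·I₁, g₁·I₁ ⊆ I₂` and `2^k f₂·I₂, 2^k g₂·I₂ ⊆ I₁`:
  **`∃ i i′, char_Λ((N_Σ/Col_Σ C₂)_ε)·(2)^i = char_Λ((N_Σ/Col_Σ C₁)_ε)·(2)^{i′}`**; and the one-sided form `…_of_le_of_sandwich` (`I₁ ⊆ I₂`).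

What remains for D4χ after this file is ARITHMETIC only: the two containments between `φ_ε(Col_Σ A_χ)` and `φ_ε(Col_Σ B_χ)` (memo §3/§4; they need
Rubin's print `theta0_mem_rayClassField` and Robert's Lemma, finding F57 of seat g26).

## References
* [deShalit1987] E. de Shalit, *Iwasawa theory of elliptic curves with complex multiplication* (1987), II §4.12 (29)–(32); III §1.3, §1.4 (5),
  Cor. 1.5 (7), §1.8 (14)–(15), Lemma 1.10 (17).
* [Rubin1991] K. Rubin, Invent. Math. 103 (1991), §4 p. 36.
* [Washington1997] L. C. Washington, *Introduction to Cyclotomic Fields* (1997), §13.2.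
* [SerreLocalFields1979] J.-P. Serre, *Local Fields* (1979), Ch. I §1.
-/

noncomputable section

set_option linter.dupNamespace false
set_option autoImplicit false

open Filter Topology
open scoped PowerSeries.WithPiTopology

namespace Summit.BirchSwinnertonDyer.BirchSwinnertonDyer.Theorems.PrintCf2.ColemanCoinvariantTraceSandwich

open Literature.NumberTheory.GaloisRepresentations Literature.NumberTheory.GaloisRepresentations.IsNonarchimedeanLocalField
  Literature.NumberTheory.GaloisRepresentations.LubinTate ValuativeRel Field
open Literature.NumberTheory.EllipticCurves
open Summit.BirchSwinnertonDyer.BirchSwinnertonDyer.Theorems.PrintCf2.ColemanImage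
open Summit.BirchSwinnertonDyer.BirchSwinnertonDyer.Theorems.PrintCf2.ColemanCoinvariantTrace

variable {F : Type} [Field F] [ValuativeRel F] [TopologicalSpace F] [IsNonarchimedeanLocalField F]

attribute [local instance] ltNormUniformSpace ltNormIsUniformAddGroup rk1 nF nE fintypeResidueField
attribute [local instance] RelNormCoherentUnits.instCommMonoid
attribute [local instance] isAdicComplete_maximalIdeal_powerSeries_integer

/-! ## §1. `2` is a prime element of `Λ = 𝒪_F⟦X⟧⟦T⟧` when `2 = π·t` -/

section PrimeTwo

variable {π : 𝒪[F]} (hπ : (valuation F).IsUniformizer (π : F)) {t : 𝒪[F]ˣ} (ht : (2 : 𝒪[F]) = π * t)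

include hπ in
/-- A uniformiser is a prime element of `𝒪_F` (`(π) = 𝔪` is maximal and non-zero). [cite: SerreLocalFields1979, Ch. I §1] -/
theorem prime_uniformizer_integer : Prime π := by
  have hne : π ≠ 0 := fun h ↦ hπ.ne_zero (by rw [h]; rfl)
  rw [← Ideal.span_singleton_prime hne, ← maximalIdeal_eq_span_singleton hπ]
  exact (IsLocalRing.maximalIdeal.isMaximal 𝒪[F]).isPrime

include hπ ht in
/-- `2` is a prime element of `𝒪_F` when `2 = π·t` with `t` a unit (e.g. `F = ℚ₂`). [cite: SerreLocalFields1979, Ch. I §1] -/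
theorem prime_two_integer : Prime (2 : 𝒪[F]) := by
  rw [ht]
  exact (associated_mul_unit_left π (t : 𝒪[F]) t.isUnit).prime_iff.mpr (prime_uniformizer_integer hπ)

include hπ ht in
/-- ★ **`2` is a prime element of `Λ = 𝒪_F⟦X⟧⟦T⟧`** (`2 = C (C 2)`; `prime_C_of_prime` twice). [cite: Washington1997, §13.2] [cite: SerreLocalFields1979, Ch. I §1] -/
theorem prime_two_powerSeries_powerSeries : Prime (2 : PowerSeries (PowerSeries 𝒪[F])) := by
  have h : (2 : PowerSeries (PowerSeries 𝒪[F])) = PowerSeries.C (PowerSeries.C (2 : 𝒪[F])) := by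
    rw [map_ofNat, map_ofNat]
  rw [h]
  exact prime_C_of_prime (prime_C_of_prime (prime_two_integer hπ ht))

end PrimeTwo

/-! ## §2. The sandwich on the trace -/

variable {p : ℕ} [hp : Fact p.Prime] {d : ℕ} (hd : d.Coprime p)
variable {π : 𝒪[F]} (hπ : (valuation F).IsUniformizer (π : F))
variable (E : ℕ → IntermediateField F (AlgebraicClosure F)) [∀ m, FiniteDimensional F (E m)] [∀ m, Normal F (E m)]
  [∀ m, IsGalois F (E m)] (hmono : Monotone E) (hE : ∀ m, E m ≤ maxUnramified F) (hdeg : ∀ m, Module.finrank F (E m) = d * p ^ m)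
  {σ₀ : absoluteGaloisGroup F} (hσ₀ : IsAbsArithFrob σ₀) (hq : residueFieldCard F = 2)
variable (u : (LTCoeff F)ˣ) (hu : LTCoeff.of F π = residueFieldCard F * u) (γ w : 𝒪[F]ˣ) (hγ : (γ : 𝒪[F]) = 1 + π ^ 2 * w)
variable [IsAdicComplete (Ideal.span {intBase F (LTCoeff.of F π)}) (PowerSeries 𝒪[F])] [NeZero d]
variable {θ : ∀ m, unitBall (E m)} (hθ : ∀ m, IsIntegralNormalGen (E m) (θ m))
  (hcoh : ∀ m, unitBallTrace (hmono (Nat.le_succ m)) (θ (m + 1)) = θ m)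
variable [CharZero F] [IsAdicComplete (Ideal.span {(p : 𝒪[F])}) 𝒪[F]] (hI : Ideal.span {(p : 𝒪[F])} ≠ ⊤)
  (hud : ∀ m, (u : LTCoeff F) ^ Module.finrank F (E m) ≠ 1) (hm : ∃ m₁ : ℕ, LTCoeff.of F π ^ 2 ∣ LTCoeff.of F π - m₁)
  (hN : DenseRange (Nat.cast : ℕ → 𝒪[F]))
  (C₁ : Set (∀ m, RelNormCoherentUnits hπ (E m))) (hC₁ : IsClosed C₁) (hC₁sub : C₁ ⊆ principalCoherentFamilies hπ E hmono)
  (h1₁ : (fun m => (RelNormCoherentUnits.one : RelNormCoherentUnits hπ (E m))) ∈ C₁)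
  (hmul₁ : ∀ β ∈ C₁, ∀ β' ∈ C₁, (fun m => (β m).mul (β' m)) ∈ C₁) (hinv₁ : ∀ β ∈ C₁, (fun m => (β m).inv hπ (E m)) ∈ C₁)
  (hgal₁ : ∀ σ : absoluteGaloisGroup F, ∀ β ∈ C₁, (fun m => (β m).galAct σ) ∈ C₁)
  (C₂ : Set (∀ m, RelNormCoherentUnits hπ (E m))) (hC₂ : IsClosed C₂) (hC₂sub : C₂ ⊆ principalCoherentFamilies hπ E hmono)
  (h1₂ : (fun m => (RelNormCoherentUnits.one : RelNormCoherentUnits hπ (E m))) ∈ C₂)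
  (hmul₂ : ∀ β ∈ C₂, ∀ β' ∈ C₂, (fun m => (β m).mul (β' m)) ∈ C₂) (hinv₂ : ∀ β ∈ C₂, (fun m => (β m).inv hπ (E m)) ∈ C₂)
  (hgal₂ : ∀ σ : absoluteGaloisGroup F, ∀ β ∈ C₂, (fun m => (β m).galAct σ) ∈ C₂)

include hE hdeg hσ₀ hcoh hm in
/-- ★★★ **THE SANDWICH ON THE TRACE.**  Let `C₁, C₂ ⊆ 𝒰¹_∞` be closed `Γ_F`-stable subgroups, `I_j := φ_ε(Col_Σ C_j) ≤ Λ = 𝒪_F⟦X⟧⟦T⟧`, `2` prime in `Λ`,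
`ε² = 1`.  If `f₁·I₁ ⊆ I₂`, `g₁·I₁ ⊆ I₂` for a prime `f₁ ∤ g₁` and `2^k f₂·I₂ ⊆ I₁`, `2^k g₂·I₂ ⊆ I₁` for a prime `f₂ ∤ g₂`, then
**`∃ i i′, char_Λ((N_Σ/Col_Σ C₂)_ε)·(2)^i = char_Λ((N_Σ/Col_Σ C₁)_ε)·(2)^{i′}`** (both sides are `char_Λ(Λ/I_j)`, then the generic sandwich).
[cite: deShalit1987, III §1.4 (5), §1.8 (14)–(15), Lemma 1.10 (17)] [cite: Washington1997, §13.2] -/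
theorem exists_charIdeal_coinvariants_colemanImageTrace_mul_span_two_pow_eq_of_sandwich (ε : PowerSeries (PowerSeries 𝒪[F])) (hε : ε * ε = 1)
    (h2 : Prime (2 : PowerSeries (PowerSeries 𝒪[F]))) {f₁ g₁ f₂ g₂ : PowerSeries (PowerSeries 𝒪[F])} (k : ℕ)
    (hf₁ : Prime f₁) (hfg₁ : ¬ f₁ ∣ g₁) (hf₂ : Prime f₂) (hfg₂ : ¬ f₂ ∣ g₂)
    (h₁f : ∀ a ∈ (colemanImageTrace hd hπ E hmono hE hdeg hσ₀ hq u hu γ hθ hcoh hN C₁ hC₁ hC₁sub h1₁ hmul₁ hinv₁ hgal₁).map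
        (colemanDeltaCoinvFun hπ hq (intBase F) u hu γ (eq_zero_of_C_pi_mul_eq_zero_integer hπ) w hγ ε),
      f₁ • a ∈ (colemanImageTrace hd hπ E hmono hE hdeg hσ₀ hq u hu γ hθ hcoh hN C₂ hC₂ hC₂sub h1₂ hmul₂ hinv₂ hgal₂).map
        (colemanDeltaCoinvFun hπ hq (intBase F) u hu γ (eq_zero_of_C_pi_mul_eq_zero_integer hπ) w hγ ε))
    (h₁g : ∀ a ∈ (colemanImageTrace hd hπ E hmono hE hdeg hσ₀ hq u hu γ hθ hcoh hN C₁ hC₁ hC₁sub h1₁ hmul₁ hinv₁ hgal₁).map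
        (colemanDeltaCoinvFun hπ hq (intBase F) u hu γ (eq_zero_of_C_pi_mul_eq_zero_integer hπ) w hγ ε),
      g₁ • a ∈ (colemanImageTrace hd hπ E hmono hE hdeg hσ₀ hq u hu γ hθ hcoh hN C₂ hC₂ hC₂sub h1₂ hmul₂ hinv₂ hgal₂).map
        (colemanDeltaCoinvFun hπ hq (intBase F) u hu γ (eq_zero_of_C_pi_mul_eq_zero_integer hπ) w hγ ε))
    (h₂f : ∀ b ∈ (colemanImageTrace hd hπ E hmono hE hdeg hσ₀ hq u hu γ hθ hcoh hN C₂ hC₂ hC₂sub h1₂ hmul₂ hinv₂ hgal₂).map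
        (colemanDeltaCoinvFun hπ hq (intBase F) u hu γ (eq_zero_of_C_pi_mul_eq_zero_integer hπ) w hγ ε),
      (2 ^ k * f₂) • b ∈ (colemanImageTrace hd hπ E hmono hE hdeg hσ₀ hq u hu γ hθ hcoh hN C₁ hC₁ hC₁sub h1₁ hmul₁ hinv₁ hgal₁).map
        (colemanDeltaCoinvFun hπ hq (intBase F) u hu γ (eq_zero_of_C_pi_mul_eq_zero_integer hπ) w hγ ε))
    (h₂g : ∀ b ∈ (colemanImageTrace hd hπ E hmono hE hdeg hσ₀ hq u hu γ hθ hcoh hN C₂ hC₂ hC₂sub h1₂ hmul₂ hinv₂ hgal₂).map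
        (colemanDeltaCoinvFun hπ hq (intBase F) u hu γ (eq_zero_of_C_pi_mul_eq_zero_integer hπ) w hγ ε),
      (2 ^ k * g₂) • b ∈ (colemanImageTrace hd hπ E hmono hE hdeg hσ₀ hq u hu γ hθ hcoh hN C₁ hC₁ hC₁sub h1₁ hmul₁ hinv₁ hgal₁).map
        (colemanDeltaCoinvFun hπ hq (intBase F) u hu γ (eq_zero_of_C_pi_mul_eq_zero_integer hπ) w hγ ε)) :
    ∃ i i' : ℕ,
      Module.charIdeal (PowerSeries (PowerSeries 𝒪[F]))
          (↥(unitsImageTrace hd hπ E hmono hE hdeg hσ₀ hq u hu γ hθ hcoh hI hud) ⧸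
            colemanCoinvRel hπ hq (intBase F) u hu γ ε (unitsImageTrace hd hπ E hmono hE hdeg hσ₀ hq u hu γ hθ hcoh hI hud)
              (fun _ hG => unitTwistₗ_mem_unitsImageTrace hd hπ E hmono hE hdeg hσ₀ hq u hu γ hθ hcoh hI hud (-1) hG)
              (colemanImageTrace hd hπ E hmono hE hdeg hσ₀ hq u hu γ hθ hcoh hN C₂ hC₂ hC₂sub h1₂ hmul₂ hinv₂ hgal₂)) *
        Ideal.span {(2 : PowerSeries (PowerSeries 𝒪[F]))} ^ i =
      Module.charIdeal (PowerSeries (PowerSeries 𝒪[F]))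
          (↥(unitsImageTrace hd hπ E hmono hE hdeg hσ₀ hq u hu γ hθ hcoh hI hud) ⧸
            colemanCoinvRel hπ hq (intBase F) u hu γ ε (unitsImageTrace hd hπ E hmono hE hdeg hσ₀ hq u hu γ hθ hcoh hI hud)
              (fun _ hG => unitTwistₗ_mem_unitsImageTrace hd hπ E hmono hE hdeg hσ₀ hq u hu γ hθ hcoh hI hud (-1) hG)
              (colemanImageTrace hd hπ E hmono hE hdeg hσ₀ hq u hu γ hθ hcoh hN C₁ hC₁ hC₁sub h1₁ hmul₁ hinv₁ hgal₁)) *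
        Ideal.span {(2 : PowerSeries (PowerSeries 𝒪[F]))} ^ i' := by
  rw [charIdeal_coinvariants_colemanImageTrace_eq hd hπ E hmono hE hdeg hσ₀ hq u hu γ w hγ hθ hcoh hI hud hm hN C₂ hC₂ hC₂sub h1₂ hmul₂ hinv₂ hgal₂ ε hε,
    charIdeal_coinvariants_colemanImageTrace_eq hd hπ E hmono hE hdeg hσ₀ hq u hu γ w hγ hθ hcoh hI hud hm hN C₁ hC₁ hC₁sub h1₁ hmul₁ hinv₁ hgal₁ ε hε]
  exact Module.exists_charIdeal_quotient_mul_span_pow_eq_of_two_sided_sandwich _ _ k h2 hf₁ hfg₁ hf₂ hfg₂ h₁f h₁g h₂f h₂g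

include hE hdeg hσ₀ hcoh hm in
/-- ★★ **One-sided form**: if `I₁ ⊆ I₂` (e.g. `C₁ ⊆ C₂`) and `2^k f₂·I₂ ⊆ I₁`, `2^k g₂·I₂ ⊆ I₁` for a prime `f₂ ∤ g₂`, then
`∃ i i′, char_Λ((N_Σ/Col_Σ C₂)_ε)·(2)^i = char_Λ((N_Σ/Col_Σ C₁)_ε)·(2)^{i′}`. [cite: deShalit1987, III §1.4 (5), Lemma 1.10 (17)] [cite: Washington1997, §13.2] -/
theorem exists_charIdeal_coinvariants_colemanImageTrace_mul_span_two_pow_eq_of_le_of_sandwich (ε : PowerSeries (PowerSeries 𝒪[F]))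
    (hε : ε * ε = 1) (h2 : Prime (2 : PowerSeries (PowerSeries 𝒪[F]))) {f₂ g₂ : PowerSeries (PowerSeries 𝒪[F])} (k : ℕ)
    (hf₂ : Prime f₂) (hfg₂ : ¬ f₂ ∣ g₂)
    (hle : (colemanImageTrace hd hπ E hmono hE hdeg hσ₀ hq u hu γ hθ hcoh hN C₁ hC₁ hC₁sub h1₁ hmul₁ hinv₁ hgal₁).map
        (colemanDeltaCoinvFun hπ hq (intBase F) u hu γ (eq_zero_of_C_pi_mul_eq_zero_integer hπ) w hγ ε) ≤
      (colemanImageTrace hd hπ E hmono hE hdeg hσ₀ hq u hu γ hθ hcoh hN C₂ hC₂ hC₂sub h1₂ hmul₂ hinv₂ hgal₂).map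
        (colemanDeltaCoinvFun hπ hq (intBase F) u hu γ (eq_zero_of_C_pi_mul_eq_zero_integer hπ) w hγ ε))
    (h₂f : ∀ b ∈ (colemanImageTrace hd hπ E hmono hE hdeg hσ₀ hq u hu γ hθ hcoh hN C₂ hC₂ hC₂sub h1₂ hmul₂ hinv₂ hgal₂).map
        (colemanDeltaCoinvFun hπ hq (intBase F) u hu γ (eq_zero_of_C_pi_mul_eq_zero_integer hπ) w hγ ε),
      (2 ^ k * f₂) • b ∈ (colemanImageTrace hd hπ E hmono hE hdeg hσ₀ hq u hu γ hθ hcoh hN C₁ hC₁ hC₁sub h1₁ hmul₁ hinv₁ hgal₁).map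
        (colemanDeltaCoinvFun hπ hq (intBase F) u hu γ (eq_zero_of_C_pi_mul_eq_zero_integer hπ) w hγ ε))
    (h₂g : ∀ b ∈ (colemanImageTrace hd hπ E hmono hE hdeg hσ₀ hq u hu γ hθ hcoh hN C₂ hC₂ hC₂sub h1₂ hmul₂ hinv₂ hgal₂).map
        (colemanDeltaCoinvFun hπ hq (intBase F) u hu γ (eq_zero_of_C_pi_mul_eq_zero_integer hπ) w hγ ε),
      (2 ^ k * g₂) • b ∈ (colemanImageTrace hd hπ E hmono hE hdeg hσ₀ hq u hu γ hθ hcoh hN C₁ hC₁ hC₁sub h1₁ hmul₁ hinv₁ hgal₁).map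
        (colemanDeltaCoinvFun hπ hq (intBase F) u hu γ (eq_zero_of_C_pi_mul_eq_zero_integer hπ) w hγ ε)) :
    ∃ i i' : ℕ,
      Module.charIdeal (PowerSeries (PowerSeries 𝒪[F]))
          (↥(unitsImageTrace hd hπ E hmono hE hdeg hσ₀ hq u hu γ hθ hcoh hI hud) ⧸
            colemanCoinvRel hπ hq (intBase F) u hu γ ε (unitsImageTrace hd hπ E hmono hE hdeg hσ₀ hq u hu γ hθ hcoh hI hud)
              (fun _ hG => unitTwistₗ_mem_unitsImageTrace hd hπ E hmono hE hdeg hσ₀ hq u hu γ hθ hcoh hI hud (-1) hG)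
              (colemanImageTrace hd hπ E hmono hE hdeg hσ₀ hq u hu γ hθ hcoh hN C₂ hC₂ hC₂sub h1₂ hmul₂ hinv₂ hgal₂)) *
        Ideal.span {(2 : PowerSeries (PowerSeries 𝒪[F]))} ^ i =
      Module.charIdeal (PowerSeries (PowerSeries 𝒪[F]))
          (↥(unitsImageTrace hd hπ E hmono hE hdeg hσ₀ hq u hu γ hθ hcoh hI hud) ⧸
            colemanCoinvRel hπ hq (intBase F) u hu γ ε (unitsImageTrace hd hπ E hmono hE hdeg hσ₀ hq u hu γ hθ hcoh hI hud)
              (fun _ hG => unitTwistₗ_mem_unitsImageTrace hd hπ E hmono hE hdeg hσ₀ hq u hu γ hθ hcoh hI hud (-1) hG)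
              (colemanImageTrace hd hπ E hmono hE hdeg hσ₀ hq u hu γ hθ hcoh hN C₁ hC₁ hC₁sub h1₁ hmul₁ hinv₁ hgal₁)) *
        Ideal.span {(2 : PowerSeries (PowerSeries 𝒪[F]))} ^ i' := by
  rw [charIdeal_coinvariants_colemanImageTrace_eq hd hπ E hmono hE hdeg hσ₀ hq u hu γ w hγ hθ hcoh hI hud hm hN C₂ hC₂ hC₂sub h1₂ hmul₂ hinv₂ hgal₂ ε hε,
    charIdeal_coinvariants_colemanImageTrace_eq hd hπ E hmono hE hdeg hσ₀ hq u hu γ w hγ hθ hcoh hI hud hm hN C₁ hC₁ hC₁sub h1₁ hmul₁ hinv₁ hgal₁ ε hε]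
  exact Module.exists_charIdeal_quotient_mul_span_pow_eq_of_le_of_smul_le _ _ hle k h2 hf₂ hfg₂ h₂f h₂g

end Summit.BirchSwinnertonDyer.BirchSwinnertonDyer.Theorems.PrintCf2.ColemanCoinvariantTraceSandwich

end
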